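import Summits.QuantumFields.YangMills.Theorems.FluctuationComparisonRegPrIntLWregChainNull
import Summits.QuantumFields.YangMills.Theorems.FluctuationComparisonRegPrIntLWregChartChainBlindness
import Literature.MathematicalPhysics.QuantumFieldTheory.Balaban1983to89.T4TriangularFibredChart
import Literature.MathematicalPhysics.QuantumFieldTheory.Balaban1983to89.Node00.RegSetOfFibredChartOnSupport
import Literature.MathematicalPhysics.QuantumFieldTheory.Balaban1983to89.B12ContinuousTransportInvariance
import Literature.MathematicalPhysics.QuantumFieldTheory.Balaban1983to89.B12ContinuousTransportInvarianceOn
import HarnessLib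

/-!
# PORT F2a — CHART-ALG III (§0e of `Lines/wreg_chart.lean` v20, VERBATIM): blindness to the private coordinates, joint measurability, per-bond inverses, the fibred chart of `Ū⁽ⁿ⁾`

Cell `ym3-torus` (HUMAN RULING D-0037 — YM₃ on T³ is ladder rung R3, not the Clay problem), width seat `ym3-torus-px11` g8; count-neutral helper
(`--kind proof --supports stmt-QuantumFields-20520 --as helper`).  A PORT IS BOOKKEEPING: every declaration below is a VERBATIM move of a declaration PROVED in the
Cruxes workfile `Cruxes/FluctuationComparisonRegPrIntL/Lines/wreg_chart.lean` v20 (ideator ym-r3-idea-1 g18, LINE g18-2; 116 decls, 0 `sorry`), per the PORT MAP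
`Lines/wreg_chart_port.md` (its file F2, split at the section seams to respect the 400-line rule), so that the organ WREG becomes importable BY NAME.
Nothing new is proved; WREG is one organ of S2β; EXW ∕ GAP ∕ LAPLACE ∕ H4ᶜ ∕ LFR♯ᶜ and the package's stubs are untouched; crux stmt-QuantumFields-20520 is
NOT closed; no summit statement is proved; rung R3 = YM₃ on T³ (SU(2)) — NOT d = 4, NOT infinite volume, NOT a mass gap, NOT Clay.
References: T. Bałaban, CMP 109 (1987) 249–301 [Balaban1987RG1] ((0.4) p.253, (2.9)–(2.10) pp.266–267); A. S. Kechris, Classical Descriptive Set Theory (1995) [Kechris1995].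

THIS FILE (F2a) = §0e CHART-ALG III (v20 ll. 1132–1377; 7 of its 9 decls — the two resampling letters `update_extend_eq` ∕ `extend_comp_eq` are taken BY NAME
from ✓p730302 `…WregChartChainBlindness`, statement-identical, gate `dedup.landed`): BLINDNESS of the chain data to the
level-`n` private coordinates `chainMap_extend` ∕ `iter_extend_eq` ∕ `chainWindow_extend`; joint measurability `measurableSet_chainWindow₂`; per-bond Lusin–Souslin
inversion `exists_chainCharts_lb` ∕ `exists_chainCharts`; T⁴'s generic fibred chart for the whole tower `exists_fibredChart_iter`.  §0h follows in
`…WregFibredChartReg` and §0f in `…WregDescendChart` (same namespace `…FluctuationComparisonRegPrIntLWregFibredChart`).  F1's names (px13 g8's F1a∕F1b∕F1c `…WregChain`∕`…WregChainLaw`∕`…WregChainNull`, one namespace `…WregChain`: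
`iterCentralBond`, `chainMap`, `chainWindow`, `chainMap_injOn`, `chain_forwardLaw_lb`, …) are used BY NAME; the v20 `section ChainLawSec` preamble
(opens + `variable {P : Params}`) is re-opened verbatim.  The only deviation from v20: the section-scoped heartbeat-budget line of `section Blind` is DROPPED (the file elaborates at the farm default and under a file-global 100 000 twin).
-/

noncomputable section

open MeasureTheory Filter Topology Set
open scoped ENNReal NNReal
open Literature.MathematicalPhysics.QuantumFieldTheory.Balaban1983to89
open Literature.MathematicalPhysics.QuantumFieldTheory.Balaban1983to89.T3ContinuumYM3Torus
open Literature.MathematicalPhysics.QuantumFieldTheory.Balaban1983to89.T3NestedUnitLaws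
open Literature.MathematicalPhysics.QuantumFieldTheory.Balaban1983to89.T3UnitLawDensityEML
open Literature.MathematicalPhysics.QuantumFieldTheory.Balaban1983to89.T3UnitScaleTilt
open Literature.MathematicalPhysics.QuantumFieldTheory.Balaban1983to89.T3TiltDescent
open Literature.MathematicalPhysics.QuantumFieldTheory.Balaban1983to89.T3PrintedRegularMinimiser
open Literature.MathematicalPhysics.QuantumFieldTheory.Balaban1983to89.T3ConstrainedMinimiser (fibre)
open Literature.MathematicalPhysics.QuantumFieldTheory.Balaban1983to89.T3LevelShift
open Literature.MathematicalPhysics.QuantumFieldTheory.Balaban1983to89.Missing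
open Literature.MathematicalPhysics.QuantumFieldTheory.Balaban1983to89.T4Continuum
open scoped Literature.MathematicalPhysics.QuantumFieldTheory.Balaban1983to89.T3OrbitAverage

namespace Summit.QuantumFields.YangMills.Theorems.FluctuationComparisonRegPrIntLWregFibredChart

open Summit.QuantumFields.YangMills.Theorems.FluctuationComparisonRegPrIntLWregChain

section ChainLawSec

open Function
open Literature.MathematicalPhysics.QuantumFieldTheory.Balaban1983to89.BlockAveraging (Idx avgFun measurable_avgFun)
open Literature.MathematicalPhysics.QuantumFieldTheory.Balaban1983to89.BlockAveragingHaarAC (centralBond centralBond_injective isLocal_avgFun pre post)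
open Literature.MathematicalPhysics.QuantumFieldTheory.Balaban1983to89.BlockAveragingEMLHaarAC (fibreFamily offCard)
open Literature.MathematicalPhysics.QuantumFieldTheory.Balaban1983to89.ExpMeanLog (expMeanLogSU deltaSU deltaSU_pos measurable_expMeanLogSU_E)
open Literature.MathematicalPhysics.QuantumFieldTheory.Balaban1983to89.Node00 (SU)
open Summit.QuantumFields.YangMills.BalabanUVNodes.N09CentralWindowAtRecord (avgFun_update_centralBond_injOn_centralWindow mem_injWindow_of_mem_centralWindow)
open Summit.QuantumFields.YangMills.BalabanUVNodes.N09CentralWindowForwardLaw (isClosed_centralWindowW)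
open Summit.QuantumFields.YangMills.BalabanUVNodes.N09CentralWindowForwardLawAtRecord (exists_jacobian_forwardLaws_continuousOn)
open Summit.QuantumFields.YangMills.BalabanUVNodes.N07AveragingLocalContinuity (continuousAt_avgFun_apply_of_small)
open Summit.QuantumFields.YangMills.BalabanUVNodes.N09CentralWindowInverseContinuous (isClosed_centralWindow)
open Literature.Topology.ParametricInverse (continuousOn_of_isClosed_graph)

variable {P : Params}

/-! ## §0e CHART-ALG III: the fibred chart of the iterated averaging (blindness to private coordinates, joint measurability, per-bond inverses). -/

-- §0e's two resampling letters `update_extend_eq` ∕ `extend_comp_eq` (v20 `section Resample`, ll. 1134–1168) are NOT re-ported: statement-identical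
-- editions are already LANDED in ✓p730302 `…Theorems.FluctuationComparisonRegPrIntLWregChartChainBlindness` (px17 g6) and are used BY NAME below
-- (gate `dedup.landed`; cite-not-restate).
open Summit.QuantumFields.YangMills.Theorems.FluctuationComparisonRegPrIntLWregChartChainBlindness (update_extend_eq extend_comp_eq)

section Blind

variable {G : Type*} [GaugeGroup G]

/-- ★ **THE CHAIN MAP IS BLIND TO RESAMPLING ALL LEVEL-`n` PRIVATE COORDINATES** (locality of the iterated averaging, §0). [folklore] -/
theorem chainMap_extend (ℰ : LoopAverage G) {n : ℕ} (hn : n ≤ P.m + P.K) (g : PBond P n → G) (U : GaugeField P 0 G) (c : PBond P n) :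
    chainMap ℰ n (extend (iterCentralBond n) g U) c = chainMap ℰ n U c := by
  funext h
  unfold chainMap
  rw [update_extend_eq (iterCentralBond_injective hn),
    T4TriangularPushforward.apply_resample_eq (isLocal_iter_blockAvg (P := P) ℰ hn) (iterCentralBond_injective hn) U (update g c h) c, update_self]

/-- ★ **THE LEVEL-`n` ENVIRONMENT OF A CONFIGURATION RESAMPLED AT THE LEVEL-`(n+1)` PRIVATE COORDINATES** is the old … -/
theorem iter_extend_eq (ℰ : LoopAverage G) {n : ℕ} (hn : n + 1 ≤ P.m + P.K) (g : PBond P (n + 1) → G) (U : GaugeField P 0 G) :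
    Averaging.iter (fun i => BlockAveraging.blockAvg (P := P) (j := i) ℰ) n (extend (iterCentralBond (n + 1)) g U) =
      extend centralBond (fun b => chainMap ℰ n U (centralBond b) (g b))
        (Averaging.iter (fun i => BlockAveraging.blockAvg (P := P) (j := i) ℰ) n U) := by
  have hβ := iterCentralBond_injective (P := P) (n := n) (by omega)
  have hcb : Injective (centralBond : PBond P (n + 1) → PBond P n) := centralBond_injective (by omega)
  have hE : extend (iterCentralBond (n + 1)) g U =
      extend (iterCentralBond n) (extend centralBond g (U ∘ iterCentralBond n)) U :=
    extend_comp_eq hβ hcb g U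
  rw [hE]
  funext b
  rw [T4TriangularPushforward.apply_resample_eq (isLocal_iter_blockAvg (P := P) ℰ (by omega)) hβ]
  by_cases hb : ∃ b', centralBond b' = b
  · obtain ⟨b', rfl⟩ := hb
    rw [hcb.extend_apply, hcb.extend_apply]
    rfl
  · rw [extend_apply' _ _ _ hb, extend_apply' _ _ _ hb, Function.comp_apply, update_eq_self]

variable {N : ℕ} [NeZero N]

/-- ★★ The iterated central window is blind to resampling all level-`n` private coordinates. [cite: Balaban1987RG1, (0.4) p.253 (bookkeeping)] -/
theorem chainWindow_extend (α : ℝ) :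
    ∀ {n : ℕ}, n ≤ P.m + P.K → ∀ (g : PBond P n → SU N) (U : GaugeField P 0 (SU N)) (c : PBond P n),
      chainWindow α n (extend (iterCentralBond n) g U) c = chainWindow α n U c
  | 0, _ => fun _ _ _ => rfl
  | n + 1, hn => fun g U c => by
      have hβ := iterCentralBond_injective (P := P) (n := n) (by omega)
      have hcb : Injective (centralBond : PBond P (n + 1) → PBond P n) := centralBond_injective (by omega)
      have hE : extend (iterCentralBond (n + 1)) g U =
          extend (iterCentralBond n) (extend centralBond g (U ∘ iterCentralBond n)) U :=
        extend_comp_eq hβ hcb g U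
      have hwin : centralWindowSet (Averaging.iter (fun i => BlockAveraging.blockAvg (P := P) (j := i) (expMeanLogSU (n := Fin N))) n
            (extend (iterCentralBond (n + 1)) g U)) c α =
          centralWindowSet (Averaging.iter (fun i => BlockAveraging.blockAvg (P := P) (j := i) (expMeanLogSU (n := Fin N))) n U) c α := by
        rw [iter_extend_eq _ hn]
        exact Summit.QuantumFields.YangMills.BalabanUVNodes.N09CentralWindowAtRecord.centralWindow_extend hn c α _ _
      rw [chainWindow_succ, chainWindow_succ, hwin, hE, chainWindow_extend α (n := n) (by omega), chainMap_extend _ (by omega)]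

end Blind

section JointWindow

variable {N : ℕ} [NeZero N]

/-- The iterated central window is JOINTLY measurable in the environment and the pivot variable. [cite: Balaban1987RG1, (2.9) p.266 (bookkeeping)] -/
theorem measurableSet_chainWindow₂ (α : ℝ) :
    ∀ (n : ℕ) (c : PBond P n), MeasurableSet {p : GaugeField P 0 (SU N) × SU N | p.2 ∈ chainWindow α n p.1 c}
  | 0, _ => by
      simp only [chainWindow, Set.mem_univ, Set.setOf_true]
      exact MeasurableSet.univ
  | n + 1, c => by
      have hiter := T4Continuum.measurable_iter (fun i => BlockAveraging.blockAvg (P := P) (j := i) (expMeanLogSU (n := Fin N)))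
        (fun j => by rw [BlockAveraging.blockAvg_avg]; exact measurable_avgFun _ measurable_expMeanLogSU_E) n
      have hset : {p : GaugeField P 0 (SU N) × SU N | p.2 ∈ chainWindow α (n + 1) p.1 c} =
          {p | p.2 ∈ chainWindow α n p.1 (centralBond c)} ∩
            (fun p : GaugeField P 0 (SU N) × SU N =>
                (Averaging.iter (fun i => BlockAveraging.blockAvg (P := P) (j := i) (expMeanLogSU (n := Fin N))) n p.1,
                  chainMap (expMeanLogSU (n := Fin N)) n p.1 (centralBond c) p.2)) ⁻¹'
              {q : GaugeField P n (SU N) × SU N | ∀ i : Idx P, dist1 (fibreFamily q.1 c (pre q.1 c * q.2 * post q.1 c) i) ≤ α} := by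
        ext p
        simp only [chainWindow_succ, Set.mem_inter_iff, Set.mem_preimage, Set.mem_setOf_eq, centralWindowSet]
      rw [hset]
      exact (measurableSet_chainWindow₂ α n (centralBond c)).inter
        (((hiter.comp measurable_fst).prodMk (measurable_chainMap₂ n (centralBond c)))
          (Summit.QuantumFields.YangMills.BalabanUVNodes.N09CentralWindowAtRecord.measurableSet_centralWindow c α))

end JointWindow

section ChainCharts

variable {N : ℕ} [NeZero N]

/-- ★★ **PER-BOND INVERSION DATA OF THE CHAIN** (Lusin–Souslin inverse + inverse law). [cite: Kechris1995, Thm 15.1 and Cor 15.2] -/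
theorem exists_chainCharts_lb {α : ℝ} (hα0 : 0 ≤ α) (hα24 : α ≤ 1 / 24) (hα64 : 64 * α ≤ deltaSU (Fin N))
    (hαL : 157 * α < ((P.L : ℝ) ^ (P.d - 1))⁻¹)
    (hgap : ∀ j (c : PBond P (j + 1)), (offCard c : ℝ) / (Fintype.card (Idx P) : ℝ) + 150 * α < 1)
    {j₀ : ℝ≥0} (hvol : j₀ = 0 ∨ ChainVol P N α j₀) {n : ℕ} (hn : n ≤ P.m + P.K) :
    ∃ (T : PBond P n → GaugeField P 0 (SU N) → Set (SU N)) (ϑ : PBond P n → GaugeField P 0 (SU N) → SU N → SU N)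
      (jd : PBond P n → GaugeField P 0 (SU N) → SU N → ℝ≥0),
      (∀ c, MeasurableSet {p : GaugeField P 0 (SU N) × SU N | p.2 ∈ T c p.1}) ∧
      (∀ c, Measurable fun p : GaugeField P 0 (SU N) × SU N => ϑ c p.1 p.2) ∧
      (∀ c, Measurable fun p : GaugeField P 0 (SU N) × SU N => jd c p.1 p.2) ∧
      (∀ c U, ∀ v ∈ T c U, chainMap (expMeanLogSU (n := Fin N)) n U c (ϑ c U v) = v) ∧
      (∀ c U, (HaarData.haar : Measure (SU N)).restrict (chainWindow α n U c) =
        (((HaarData.haar : Measure (SU N)).restrict (T c U)).withDensity fun v => (jd c U v : ℝ≥0∞)).map (ϑ c U)) ∧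
      (∀ c U, T c U = chainMap (expMeanLogSU (n := Fin N)) n U c '' chainWindow α n U c) ∧
      (∀ c U, ∀ g ∈ chainWindow α n U c, ϑ c U (chainMap (expMeanLogSU (n := Fin N)) n U c g) = g) ∧
      (∀ c U, ∀ v ∈ T c U, ϑ c U v ∈ chainWindow α n U c) ∧
      (∀ c U, IsClosed (T c U)) ∧
      (∀ c U, ContinuousOn (ϑ c U) (T c U)) ∧
      (∀ c U, ContinuousOn (jd c U) (T c U)) ∧
      (∀ c U, ∀ v ∈ T c U, jd c U v ≠ 0) ∧
      (∀ c U, ∀ v ∈ T c U, j₀ ^ n * jd c U v ≤ 1) := by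
  have hαδ : α < deltaSU (Fin N) := by nlinarith [deltaSU_pos (n := Fin N)]
  have hinj : ∀ (c : PBond P n) (U : GaugeField P 0 (SU N)),
      InjOn (fun g => chainMap (expMeanLogSU (n := Fin N)) n U c g) (chainWindow α n U c) :=
    fun c U => chainMap_injOn hα0 hα24 hαδ hgap hn U c
  have key : ∀ c : PBond P n, ∃ θ : GaugeField P 0 (SU N) × SU N → SU N, Measurable θ ∧
      (∀ U, ∀ g ∈ chainWindow α n U c, θ (U, chainMap (expMeanLogSU (n := Fin N)) n U c g) = g) ∧
      (∀ U, ∀ v ∈ (fun g => chainMap (expMeanLogSU (n := Fin N)) n U c g) '' chainWindow α n U c,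
        chainMap (expMeanLogSU (n := Fin N)) n U c (θ (U, v)) = v ∧ θ (U, v) ∈ chainWindow α n U c) := fun c =>
    (Literature.MeasureTheory.Function.exists_measurable_fibrewiseInverse
      (Ψ := fun p : GaugeField P 0 (SU N) × SU N => chainMap (expMeanLogSU (n := Fin N)) n p.1 c p.2)
      (Ω := fun U => chainWindow α n U c) (measurable_chainMap₂ n c) (measurableSet_chainWindow₂ α n c) (hinj c)).2
  have keyT : ∀ c : PBond P n, MeasurableSet {p : GaugeField P 0 (SU N) × SU N |
      p.2 ∈ (fun g => chainMap (expMeanLogSU (n := Fin N)) n p.1 c g) '' chainWindow α n p.1 c} := fun c =>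
    (Literature.MeasureTheory.Function.exists_measurable_fibrewiseInverse
      (Ψ := fun p : GaugeField P 0 (SU N) × SU N => chainMap (expMeanLogSU (n := Fin N)) n p.1 c p.2)
      (Ω := fun U => chainWindow α n U c) (measurable_chainMap₂ n c) (measurableSet_chainWindow₂ α n c) (hinj c)).1
  choose θ hθm hleft hright using key
  have hJ := fun c => chain_forwardLaw_lb (N := N) (P := P) hα0 hα24 hα64 hαL hgap hvol n hn c
  choose J hJm hJ0 hJlaw hJc hJlb using hJ
  have hθc : ∀ (c : PBond P n) (U : GaugeField P 0 (SU N)),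
      ContinuousOn (fun v => θ c (U, v)) ((fun g => chainMap (expMeanLogSU (n := Fin N)) n U c g) '' chainWindow α n U c) := fun c U =>
    continuousOn_leftInverse_image (isClosed_chainWindow hαδ hn U c) (continuousOn_chainMap hαδ hn U c) (hinj c U)
      (θ := fun v => θ c (U, v)) (fun v hv => (hright c U v hv).2) (fun v hv => (hright c U v hv).1)
  refine ⟨fun c U => (fun g => chainMap (expMeanLogSU (n := Fin N)) n U c g) '' chainWindow α n U c, fun c U v => θ c (U, v),
    fun c U v => (J c U (θ c (U, v)))⁻¹, keyT, fun c => hθm c, fun c => ?_, fun c U v hv => (hright c U v hv).1, fun c U => ?_,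
    fun c U => rfl, fun c U g hg => hleft c U g hg, fun c U v hv => (hright c U v hv).2,
    fun c U => isClosed_image_chainWindow hαδ hn U c, hθc, fun c U => ?_, fun c U v hv => inv_ne_zero (hJ0 c U _ (hright c U v hv).2),
    fun c U v hv => ?lb⟩
  case lb =>
    have hx : J c U (θ c (U, v)) ≠ 0 := hJ0 c U _ (hright c U v hv).2
    calc j₀ ^ n * (J c U (θ c (U, v)))⁻¹ ≤ J c U (θ c (U, v)) * (J c U (θ c (U, v)))⁻¹ := mul_le_mul' (hJlb c U _) le_rfl
      _ = 1 := mul_inv_cancel₀ hx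
  · exact ((hJm c).comp (measurable_fst.prodMk (hθm c))).inv
  rotate_left
  · exact ((hJc c U).comp (hθc c U) fun v hv => (hright c U v hv).2).inv₀ fun v hv => hJ0 c U _ (hright c U v hv).2
  · -- the inverse law from the forward law
    have hΩU : MeasurableSet (chainWindow α n U c) := measurableSet_chainWindow α n U c
    have hθU : Measurable fun v => θ c (U, v) := (hθm c).comp (measurable_const.prodMk measurable_id)
    have hjacU : Measurable fun g => (J c U g : ℝ≥0∞) :=
      measurable_coe_nnreal_ennreal.comp ((hJm c).comp (measurable_const.prodMk measurable_id))
    have h := T4TriangularFibredChart.restrict_eq_map_withDensity_of_leftInvOn (ν := (HaarData.haar : Measure (SU N))) hΩU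
      (measurable_chainMap n U c) hθU (hleft c U) hjacU (fun g hg => by exact_mod_cast hJ0 c U g hg) (fun g _ => ENNReal.coe_ne_top) (hJlaw c U)
    rw [h]
    congr 1
    refine withDensity_congr_ae ?_
    filter_upwards [ae_restrict_mem (keyT c |> fun h => (measurable_const.prodMk measurable_id) h)] with v hv
    rw [ENNReal.coe_inv (hJ0 c U _ ((hright c U v hv).2))]

/-- ★★ Per-bond inversion data of the chain (unconditional form). [cite: Balaban1987RG1, (0.4) p.253 and (2.10) p.267] -/
theorem exists_chainCharts {α : ℝ} (hα0 : 0 ≤ α) (hα24 : α ≤ 1 / 24) (hα64 : 64 * α ≤ deltaSU (Fin N))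
    (hαL : 157 * α < ((P.L : ℝ) ^ (P.d - 1))⁻¹)
    (hgap : ∀ j (c : PBond P (j + 1)), (offCard c : ℝ) / (Fintype.card (Idx P) : ℝ) + 150 * α < 1) {n : ℕ} (hn : n ≤ P.m + P.K) :
    ∃ (T : PBond P n → GaugeField P 0 (SU N) → Set (SU N)) (ϑ : PBond P n → GaugeField P 0 (SU N) → SU N → SU N)
      (jd : PBond P n → GaugeField P 0 (SU N) → SU N → ℝ≥0),
      (∀ c, MeasurableSet {p : GaugeField P 0 (SU N) × SU N | p.2 ∈ T c p.1}) ∧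
      (∀ c, Measurable fun p : GaugeField P 0 (SU N) × SU N => ϑ c p.1 p.2) ∧
      (∀ c, Measurable fun p : GaugeField P 0 (SU N) × SU N => jd c p.1 p.2) ∧
      (∀ c U, ∀ v ∈ T c U, chainMap (expMeanLogSU (n := Fin N)) n U c (ϑ c U v) = v) ∧
      (∀ c U, (HaarData.haar : Measure (SU N)).restrict (chainWindow α n U c) =
        (((HaarData.haar : Measure (SU N)).restrict (T c U)).withDensity fun v => (jd c U v : ℝ≥0∞)).map (ϑ c U)) ∧
      (∀ c U, T c U = chainMap (expMeanLogSU (n := Fin N)) n U c '' chainWindow α n U c) ∧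
      (∀ c U, ∀ g ∈ chainWindow α n U c, ϑ c U (chainMap (expMeanLogSU (n := Fin N)) n U c g) = g) ∧
      (∀ c U, ∀ v ∈ T c U, ϑ c U v ∈ chainWindow α n U c) ∧
      (∀ c U, IsClosed (T c U)) ∧
      (∀ c U, ContinuousOn (ϑ c U) (T c U)) ∧
      (∀ c U, ContinuousOn (jd c U) (T c U)) ∧
      (∀ c U, ∀ v ∈ T c U, jd c U v ≠ 0) := by
  obtain ⟨T, ϑ, jd, h1, h2, h3, h4, h5, h6, h7, h8, h9, h10, h11, h12, -⟩ :=
    exists_chainCharts_lb (N := N) (P := P) hα0 hα24 hα64 hαL hgap (j₀ := 0) (Or.inl rfl) hn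
  exact ⟨T, ϑ, jd, h1, h2, h3, h4, h5, h6, h7, h8, h9, h10, h11, h12⟩

/-- ★★★ **CHART-ALG III** — the fibred chart of the iterated averaging. [cite: Balaban1987RG1, (0.4) p.253, (2.4) p.266 and (2.10) p.267] -/
theorem exists_fibredChart_iter {α : ℝ} (hα0 : 0 ≤ α) (hα24 : α ≤ 1 / 24) (hα64 : 64 * α ≤ deltaSU (Fin N))
    (hαL : 157 * α < ((P.L : ℝ) ^ (P.d - 1))⁻¹)
    (hgap : ∀ j (c : PBond P (j + 1)), (offCard c : ℝ) / (Fintype.card (Idx P) : ℝ) + 150 * α < 1) {n : ℕ} (hn : n ≤ P.m + P.K) :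
    ∃ (Φ : GaugeField P n (SU N) × GaugeField P 0 (SU N) → GaugeField P 0 (SU N)) (Jac : GaugeField P n (SU N) × GaugeField P 0 (SU N) → ℝ≥0),
      Measurable Φ ∧ Measurable Jac ∧
      (∀ V z, Jac (V, z) ≠ 0 → Averaging.iter (fun i => BlockAveraging.blockAvg (P := P) (j := i) (expMeanLogSU (n := Fin N))) n (Φ (V, z)) = V) ∧
      ∀ U₀ : Set (GaugeField P n (SU N)), MeasurableSet U₀ →
        (fieldMeasure P 0 (SU N)).restrict
            (Averaging.iter (fun i => BlockAveraging.blockAvg (P := P) (j := i) (expMeanLogSU (n := Fin N))) n ⁻¹' U₀ ∩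
              {U | ∀ c, U (iterCentralBond n c) ∈ chainWindow α n U c}) =
          ((((fieldMeasure P n (SU N)).restrict U₀).prod (fieldMeasure P 0 (SU N))).withDensity fun p => (Jac p : ℝ≥0∞)).map Φ := by
  obtain ⟨T, ϑ, jd, hTm, hθm, hjm, hright, hlaw, -, -, -, -, -, -, -⟩ := exists_chainCharts (N := N) (P := P) hα0 hα24 hα64 hαL hgap hn
  have hA := isLocal_iter_blockAvg (P := P) (expMeanLogSU (n := Fin N)) hn
  have hβ := iterCentralBond_injective (P := P) (n := n) hn
  have hAm : Measurable (Averaging.iter (fun i => BlockAveraging.blockAvg (P := P) (j := i) (expMeanLogSU (n := Fin N))) n) :=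
    T4Continuum.measurable_iter _ (fun j => by rw [BlockAveraging.blockAvg_avg]; exact measurable_avgFun _ measurable_expMeanLogSU_E) n
  have hright' : ∀ c U, ∀ v ∈ T c U,
      Averaging.iter (fun i => BlockAveraging.blockAvg (P := P) (j := i) (expMeanLogSU (n := Fin N))) n (update U (iterCentralBond n c) (ϑ c U v)) c = v :=
    fun c U v hv => hright c U v hv
  refine ⟨fun p => extend (iterCentralBond n) (fun c => ϑ c p.2 (p.1 c)) p.2,
    fun p => {p : GaugeField P n (SU N) × GaugeField P 0 (SU N) | ∀ c, p.1 c ∈ T c p.2}.indicator (fun p => ∏ c, jd c p.2 (p.1 c)) p,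
    T4TriangularFibredChart.measurable_triChart ϑ hβ hθm, T4TriangularFibredChart.measurable_triJacobian T jd hTm hjm,
    fun V z hJ => T4TriangularFibredChart.apply_triChart_eq_of_jacobian_ne_zero T ϑ jd hA hβ hright' hJ, fun U₀ hU₀ => ?_⟩
  exact T4TriangularFibredChart.pi_restrict_preimage_inter_eq_map_prod_withDensity (fun c U => chainWindow α n U c) T ϑ jd
    (HaarData.haar : Measure (SU N)) (HaarData.haar : Measure (SU N)) hA hβ hAm (measurableSet_chainWindow₂ α n) hTm hθm hjm
    (fun c U g => chainWindow_extend α hn g U c) hright' hlaw hU₀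

end ChainCharts

end ChainLawSec

end Summit.QuantumFields.YangMills.Theorems.FluctuationComparisonRegPrIntLWregFibredChart

end
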